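import Summits.Ventures.YMGap.RobustBall.PerturbedLimitStates
import Summits.Ventures.YMGap.RobustBall.RobustAreaLawVertex
import Summits.Ventures.YMGap.RobustBall.RectangleWitness
import Literature.Barriers.QuantumFields.RougheningTransition
import HarnessLib

/-!
# Robust ball (Y2), area-law side — STRING TENSION ON THE BALL: the infinite-volume form of the robust area law

HONEST FRAMING: venture file of the cell `pub-ymgap` (QuantumFields programme), track ROBUST-BALL, seat rb-p2 (g2).  Strong-coupling
LATTICE statements; nothing about the continuum, a spectral mass gap, or Clay.

WHAT.  rb-p2 g0's currency `AreaLawOnBall N d β ε₀ ε₁ r mv` (`RobustBall/Defs`) is a TORUS statement: ONE pair `(C, c)`, `c > 0`, such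
that `|⟨W_{R×T}⟩_{β, W, L}| ≤ C^{2(R+T)} e^{−c RT}` for every torus size `L`, every member `W` of the tier-1 ball
`ClusterDomainFR ε₀ ε₁ r ∩ IsSlabLocal mv`, and every rectangular loop with `2R, 2T ≤ L`.  Because the constants do not depend on
`L` or on the member, the bound passes to every INFINITE-VOLUME LIMIT STATE of every member family (`PerturbedLimitStates`:
`perturbedLimitPoints β 𝓦`, non-empty by compactness) and lands in the tree's `ℤ^d` currencies of
`Literature/MathematicalPhysics/QuantumLattice/WilsonLoops.lean`:
* `hasAreaLawWith_onBall` — `HasAreaLawWith μ χ_N C c` for every limit state `μ` of every eventually-member family, `χ_N = (1/N) Re tr`;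
* `stringTension_onBall` — consequently (tree: `HasAreaLawWith.le_of_hasStringTension`, Seiler LNP 159 §2) the STRING TENSION of every such
  limit state, WHENEVER IT EXISTS (`HasStringTension μ χ_N σ`: static potentials `V(R) = lim_T −log|W(R,T)|/T` for all `R` and
  `σ = lim_R V(R)/R`), satisfies `σ ≥ c` — ONE constant `c(N, d, β, ε₀, ε₁, r, mv) > 0` on the whole ball; `HasAreaLawState μ χ_N` always and
  `IsConfining μ χ_N` given existence;
* `SU(2)`, `d = 4` instances on g0's certified vertex rows `(β_W, ε) = (1/3, 0.15)`, `(1/2, 0.06)` (`su2_stringTension_onBall_oneThird/oneHalf`,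
  with `c ≤ suFundStringTension 2 μ`), and a NAMED NON-WILSON FAMILY: p1's `1×2`-rectangle member (`su2_rectangle_member_one_eighth`,
  Wilson `β_W = 1/3` plus `τ Σ_{1×2} (1 − Re tr U_∂r/2)`, `|τ| ≤ 1/2000`) — every infinite-volume limit state of it obeys the area law with the
  constants of the `β_W = 1/3` ball and confines whenever its string tension exists (`su2_rectangle_hasAreaLawWith_oneThird`).
WHAT IS NOT CLAIMED.  EXISTENCE of the static potential / string tension for a member is NOT proved here: the tree proves it for the
Wilson action via reflection positivity (`exists_hasStringTension_holds`), and a generic member `W` of the ball is not reflection positive;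
hence every string-tension clause is «whenever it exists», and the unconditional content is the `ℤ^d` area law `HasAreaLawWith` of every limit
state (which already forces `liminf −log|W(R,T)|/(RT) ≥ c`).  The currency is the tree's: rectangles in the `(0,1)` plane based at the origin.
No DLR property or uniqueness of the limit states is used or claimed.
-/

noncomputable section

open MeasureTheory Filter Topology
open Literature.Probability.LatticeModels (Site)
open Literature.MathematicalPhysics.QuantumLattice
open Literature.MathematicalPhysics.QuantumFieldTheory hiding ZdEdge Site
open Literature.Barriers.QuantumFields (suFundStringTension suFundStringTension_def)

namespace Summit.Ventures.YMGap.RobustBall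

variable {d N : ℕ}

/-- `(0 : Fin d) ≠ 1` for `d ≥ 2`. [folklore] -/
theorem fin_zero_ne_one_of_two_le [NeZero d] (hd : 2 ≤ d) : (0 : Fin d) ≠ 1 := by
  intro h01
  have := congrArg Fin.val h01
  rw [Fin.val_zero, Fin.val_one', Nat.one_mod_eq_one.mpr (by omega)] at this
  exact zero_ne_one this

/-! ### The area law of every limit state of every member family -/

/-- **A VOLUME-UNIFORM TORUS AREA LAW ON A CLASS OF MEMBERS PASSES TO EVERY LIMIT STATE, SAME CONSTANTS** (generic form: `B L` is any set of
perturbations of the torus of size `L + 1`, e.g. a tier-1 or tier-2 ball meet a slab-locality class).  If `|⟨W_{R×T}⟩_{β,W,L+1}| ≤ C^{2(R+T)}e^{−cRT}`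
for every `L`, every `W ∈ B L` and every loop with `2R, 2T ≤ L + 1` (origin, `(0,1)` plane), then every infinite-volume limit state `μ` of every
family with `𝓦 L ∈ B L` for all large `L` satisfies the tree's `HasAreaLawWith μ χ_N C c` (the bound holds on every torus of size
`≥ 2R + 2T` and is closed under the limit, `abs_rectExpectation_le_of_eventually_perturbed`). [folklore] -/
theorem hasAreaLawWith_of_torusBound [NeZero d] {β C c : ℝ} (B : (L : ℕ) → Set (Perturbation d (L + 1) N))
    (hA : ∀ (L : ℕ) (W : Perturbation d (L + 1) N), W ∈ B L → ∀ R T : ℕ, 1 ≤ R → 1 ≤ T → 2 * R ≤ L + 1 → 2 * T ≤ L + 1 →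
      |W.expectation (fundamentalRep (Fin N)) β
          (wilsonLoop (fundamentalRep (Fin N)) (0 : Literature.MathematicalPhysics.QuantumFieldTheory.Site d (L + 1)) 0 1 R T)| ≤
        C ^ (2 * (R + T)) * Real.exp (-c * (R * T)))
    (𝓦 : PerturbationFamily d N) (h𝓦 : ∀ᶠ L : ℕ in atTop, 𝓦 L ∈ B L) {μ : Measure (LGConfig d (SUN N))}
    (hμ : μ ∈ perturbedLimitPoints β 𝓦) :
    HasAreaLawWith μ (fun g => normalisedCharacter N (fundamentalRep (Fin N) g)) C c := by
  intro R T hR hT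
  have hev : ∀ᶠ L : ℕ in atTop, |(𝓦 L).expectation (fundamentalRep (Fin N)) β
      (wilsonLoop (fundamentalRep (Fin N)) (0 : Literature.MathematicalPhysics.QuantumFieldTheory.Site d (L + 1)) 0 1 R T)|
        ≤ C ^ (2 * (R + T)) * Real.exp (-c * R * T) := by
    filter_upwards [h𝓦, eventually_ge_atTop (2 * R + 2 * T)] with L hL hL'
    have h' := hA L (𝓦 L) hL R T hR hT (by omega) (by omega)
    rwa [mul_assoc]
  exact abs_rectExpectation_le_of_eventually_perturbed hμ hev

/-- **AREA LAW ON THE BALL ⇒ `ℤ^d` AREA LAW OF EVERY LIMIT STATE, SAME CONSTANTS.**  If `AreaLawOnBall N d β ε₀ ε₁ r mv` (`d ≥ 2`), there are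
`C` and `c > 0` such that for every family `𝓦` whose members lie, for all large torus sizes, in `ClusterDomainFR ε₀ ε₁ r ∩ IsSlabLocal mv`, every
infinite-volume limit state `μ ∈ perturbedLimitPoints β 𝓦` satisfies the tree's `HasAreaLawWith μ χ_N C c`:
`|W_μ(R,T)| ≤ C^{2(R+T)} e^{−cRT}` for all `R, T ≥ 1`. [folklore] -/
theorem hasAreaLawWith_onBall [NeZero d] (hd : 2 ≤ d) {β ε₀ ε₁ : ℝ} {r mv : ℕ} (h : AreaLawOnBall N d β ε₀ ε₁ r mv) :
    ∃ C c : ℝ, 0 < c ∧ ∀ 𝓦 : PerturbationFamily d N,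
      (∀ᶠ L : ℕ in atTop, 𝓦 L ∈ ClusterDomainFR ε₀ ε₁ r ∧ IsSlabLocal mv (𝓦 L)) →
        ∀ μ ∈ perturbedLimitPoints β 𝓦,
          HasAreaLawWith μ (fun g => normalisedCharacter N (fundamentalRep (Fin N) g)) C c := by
  obtain ⟨C, c, hc, hA⟩ := h
  refine ⟨C, c, hc, fun 𝓦 h𝓦 μ hμ => hasAreaLawWith_of_torusBound (β := β)
    (fun L => {W | W ∈ ClusterDomainFR ε₀ ε₁ r ∧ IsSlabLocal mv W}) (fun L W hW R T hR hT hRL hTL => ?_) 𝓦 h𝓦 hμ⟩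
  exact hA (L + 1) W hW.1 hW.2 0 0 1 R T (fin_zero_ne_one_of_two_le hd) hR hT hRL hTL

/-- **STRING TENSION ON THE BALL.**  Under `AreaLawOnBall N d β ε₀ ε₁ r mv` (`d ≥ 2`) there is ONE pair `(C, c)`, `c > 0`, such that every
infinite-volume limit state `μ` of every eventually-member family: (i) obeys the `ℤ^d` area law `HasAreaLawWith μ χ_N C c` (so `HasAreaLawState μ χ_N`);
(ii) has string tension `σ ≥ c` WHENEVER the string tension exists (`HasStringTension μ χ_N σ`; tree `HasAreaLawWith.le_of_hasStringTension`,
Seiler LNP 159 §2); (iii) is confining (`IsConfining μ χ_N`) as soon as its string tension exists.  Existence of `σ` is NOT asserted.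
[folklore] -/
theorem stringTension_onBall [NeZero d] (hd : 2 ≤ d) {β ε₀ ε₁ : ℝ} {r mv : ℕ} (h : AreaLawOnBall N d β ε₀ ε₁ r mv) :
    ∃ C c : ℝ, 0 < c ∧ ∀ 𝓦 : PerturbationFamily d N,
      (∀ᶠ L : ℕ in atTop, 𝓦 L ∈ ClusterDomainFR ε₀ ε₁ r ∧ IsSlabLocal mv (𝓦 L)) →
        ∀ μ ∈ perturbedLimitPoints β 𝓦,
          HasAreaLawWith μ (fun g => normalisedCharacter N (fundamentalRep (Fin N) g)) C c ∧
          HasAreaLawState μ (fun g => normalisedCharacter N (fundamentalRep (Fin N) g)) ∧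
          (∀ σ : ℝ, HasStringTension μ (fun g => normalisedCharacter N (fundamentalRep (Fin N) g)) σ → c ≤ σ) ∧
          ((∃ σ : ℝ, HasStringTension μ (fun g => normalisedCharacter N (fundamentalRep (Fin N) g)) σ) →
            IsConfining μ (fun g => normalisedCharacter N (fundamentalRep (Fin N) g))) := by
  obtain ⟨C, c, hc, hA⟩ := hasAreaLawWith_onBall hd h
  refine ⟨C, c, hc, fun 𝓦 h𝓦 μ hμ => ?_⟩
  have hW := hA 𝓦 h𝓦 μ hμ
  exact ⟨hW, ⟨C, c, hc, hW⟩, fun σ hσ => hW.le_of_hasStringTension hσ,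
    fun hσ => HasAreaLawState.isConfining ⟨C, c, hc, hW⟩ hσ⟩

/-- The `d = 4` reading in the tree's named string tension `suFundStringTension N μ` (`Literature/Barriers/QuantumFields/RougheningTransition`):
under `AreaLawOnBall N 4 β ε₀ ε₁ r mv`, one `c > 0` bounds from below the fundamental string tension of every limit state of every eventually-member
family whose string tension exists: `c ≤ suFundStringTension N μ`. [folklore] -/
theorem suFundStringTension_ge_onBall {β ε₀ ε₁ : ℝ} {r mv : ℕ} (h : AreaLawOnBall N 4 β ε₀ ε₁ r mv) :
    ∃ C c : ℝ, 0 < c ∧ ∀ 𝓦 : PerturbationFamily 4 N,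
      (∀ᶠ L : ℕ in atTop, 𝓦 L ∈ ClusterDomainFR ε₀ ε₁ r ∧ IsSlabLocal mv (𝓦 L)) →
        ∀ μ ∈ perturbedLimitPoints β 𝓦,
          HasAreaLawWith μ (fun g => normalisedCharacter N (fundamentalRep (Fin N) g)) C c ∧
          ((∃ σ : ℝ, HasStringTension μ (fun g => normalisedCharacter N (fundamentalRep (Fin N) g)) σ) →
            c ≤ suFundStringTension N μ) := by
  obtain ⟨C, c, hc, hA⟩ := hasAreaLawWith_onBall (N := N) (by norm_num) h
  refine ⟨C, c, hc, fun 𝓦 h𝓦 μ hμ => ⟨hA 𝓦 h𝓦 μ hμ, fun ⟨σ, hσ⟩ => ?_⟩⟩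
  rw [suFundStringTension_def, hσ.stringTension_eq]
  exact (hA 𝓦 h𝓦 μ hμ).le_of_hasStringTension hσ

/-! ### `SU(2)`, `d = 4`: the certified balls of the vertex rows -/

/-- **`SU(2)`, `d = 4`, `β_W = 1/3`, ball `(ε₀, ε₁) = (3/10, 3/20)` (any range `r`, window `mv ≥ 1`): string tension on the ball.**  One
`c > 0` such that every infinite-volume limit state of every eventually-member family satisfies `HasAreaLawWith μ χ₂ C c` and, whenever its string
tension exists, `c ≤ suFundStringTension 2 μ`.  Input: rb-p2 g0's `su2_areaLawOnBall_oneThird_vertex`. [folklore] -/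
theorem su2_stringTension_onBall_oneThird (r : ℕ) {mv : ℕ} (hmv : 1 ≤ mv) :
    ∃ C c : ℝ, 0 < c ∧ ∀ 𝓦 : PerturbationFamily 4 2,
      (∀ᶠ L : ℕ in atTop, 𝓦 L ∈ ClusterDomainFR (3 / 10) (3 / 20) r ∧ IsSlabLocal mv (𝓦 L)) →
        ∀ μ ∈ perturbedLimitPoints (1 / 6) 𝓦,
          HasAreaLawWith μ (fun g => normalisedCharacter 2 (fundamentalRep (Fin 2) g)) C c ∧
          ((∃ σ : ℝ, HasStringTension μ (fun g => normalisedCharacter 2 (fundamentalRep (Fin 2) g)) σ) →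
            c ≤ suFundStringTension 2 μ) :=
  suFundStringTension_ge_onBall (su2_areaLawOnBall_oneThird_vertex r hmv)

/-- **`SU(2)`, `d = 4`, `β_W = 1/2`, ball `(ε₀, ε₁) = (3/25, 3/50)`**: the same, from `su2_areaLawOnBall_oneHalf_vertex`. [folklore] -/
theorem su2_stringTension_onBall_oneHalf (r : ℕ) {mv : ℕ} (hmv : 1 ≤ mv) :
    ∃ C c : ℝ, 0 < c ∧ ∀ 𝓦 : PerturbationFamily 4 2,
      (∀ᶠ L : ℕ in atTop, 𝓦 L ∈ ClusterDomainFR (3 / 25) (3 / 50) r ∧ IsSlabLocal mv (𝓦 L)) →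
        ∀ μ ∈ perturbedLimitPoints (1 / 4) 𝓦,
          HasAreaLawWith μ (fun g => normalisedCharacter 2 (fundamentalRep (Fin 2) g)) C c ∧
          ((∃ σ : ℝ, HasStringTension μ (fun g => normalisedCharacter 2 (fundamentalRep (Fin 2) g)) σ) →
            c ≤ suFundStringTension 2 μ) :=
  suFundStringTension_ge_onBall (su2_areaLawOnBall_oneHalf_vertex r hmv)

/-! ### A named non-Wilson family: Wilson `β_W = 1/3` plus the `1×2`-rectangle term -/

/-! The `1×2`-RECTANGLE FAMILY of `SU(2)` actions on the tori `(ℤ/(L+1))^4` is p1's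
`fun L => termPerturbation (rectFamily 4 (L+1) 2 τ)` (total `Σ_x Σ_{i ≠ j} τ (1 − Re tr U_∂r(x;i,j)/2)`, `total_rectFamily`); it is written
out in the statements below (no new definition). -/

/-- For `SU(2)`, `d = 4`, `|τ| ≤ 1/2000`: from torus size `3` on, the rectangle family lies in the ball `(3/10, 3/20)` of range `2` and is slab-local
with window `2` (p1's `su2_rectangle_member_one_eighth`: `∈ ClusterDomainFR (13/50) (13/100) 2`, and `clusterDomainFR_mono`). [folklore] -/
theorem rectangle_eventually_mem (τ : ℝ) (hτ : |τ| ≤ 1 / 2000) :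
    ∀ᶠ L : ℕ in atTop, termPerturbation (rectFamily 4 (L + 1) 2 τ) ∈ ClusterDomainFR (3 / 10) (3 / 20) 2 ∧
      IsSlabLocal 2 (termPerturbation (rectFamily 4 (L + 1) 2 τ)) := by
  filter_upwards [eventually_ge_atTop 2] with L hL
  obtain ⟨hmem, -, hloc⟩ := su2_rectangle_member_one_eighth (L := L + 1) τ hτ (by omega)
  exact ⟨clusterDomainFR_mono (by norm_num) (by norm_num) hmem, hloc⟩

/-- **THE RECTANGLE-PERTURBED `SU(2)` ACTION CONFINES IN THE INFINITE VOLUME (area law of every limit state).**  `SU(2)`, `d = 4`, Wilson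
coupling `β_W = 1/3` (tree coupling `1/6`) plus the `1×2`-rectangle term with `|τ| ≤ 1/2000`: there are `C` and `c > 0` such that EVERY
infinite-volume limit state `μ` of the perturbed torus states (the set is non-empty, `perturbedLimitPoints_nonempty`) satisfies
`|W_μ(R,T)| ≤ C^{2(R+T)} e^{−cRT}` for all `R, T ≥ 1`, and `c ≤ suFundStringTension 2 μ` whenever the string tension of `μ` exists.  The constants
are those of the whole `β_W = 1/3` ball (they serve every other member family too). [folklore] -/
theorem su2_rectangle_hasAreaLawWith_oneThird (τ : ℝ) (hτ : |τ| ≤ 1 / 2000) :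
    ∃ C c : ℝ, 0 < c ∧ (perturbedLimitPoints (1 / 6) (fun L : ℕ => termPerturbation (rectFamily 4 (L + 1) 2 τ))).Nonempty ∧
      ∀ μ ∈ perturbedLimitPoints (1 / 6) (fun L : ℕ => termPerturbation (rectFamily 4 (L + 1) 2 τ)),
        HasAreaLawWith μ (fun g => normalisedCharacter 2 (fundamentalRep (Fin 2) g)) C c ∧
        ((∃ σ : ℝ, HasStringTension μ (fun g => normalisedCharacter 2 (fundamentalRep (Fin 2) g)) σ) →
          c ≤ suFundStringTension 2 μ) := by
  obtain ⟨C, c, hc, hA⟩ := su2_stringTension_onBall_oneThird 2 (mv := 2) (by norm_num)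
  exact ⟨C, c, hc, perturbedLimitPoints_nonempty _ _, hA _ (rectangle_eventually_mem τ hτ)⟩

/-- For `SU(2)`, `d = 4`, `|τ| ≤ 1/5000`: from torus size `3` on, the rectangle family lies in the smaller ball `(3/25, 3/50)` of the
`β_W = 1/2` row (p1's `rectFamily_mem_clusterDomainFR`: radii `(36|τ|, 360|τ|/√N)`; `√2 ≥ 1.4142`). [folklore] -/
theorem rectangle_eventually_mem' (τ : ℝ) (hτ : |τ| ≤ 1 / 5000) :
    ∀ᶠ L : ℕ in atTop, termPerturbation (rectFamily 4 (L + 1) 2 τ) ∈ ClusterDomainFR (3 / 25) (3 / 50) 2 ∧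
      IsSlabLocal 2 (termPerturbation (rectFamily 4 (L + 1) 2 τ)) := by
  filter_upwards [eventually_ge_atTop 2] with L hL
  refine ⟨clusterDomainFR_mono ?_ ?_ (rectFamily_mem_clusterDomainFR (d := 4) (L := L + 1) 2 τ),
    isSlabLocal_rectFamily 2 τ (by omega)⟩
  · norm_num; linarith [abs_nonneg τ]
  · have hs : (1.4142 : ℝ) ≤ Real.sqrt 2 := by
      rw [show (1.4142 : ℝ) = Real.sqrt (1.4142 ^ 2) by rw [Real.sqrt_sq (by norm_num)]]
      exact Real.sqrt_le_sqrt (by norm_num)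
    have hs0 : 0 < Real.sqrt 2 := by positivity
    simp only [Nat.cast_ofNat]
    rw [div_le_iff₀ hs0]
    nlinarith [abs_nonneg τ]

/-- **The rectangle-perturbed `SU(2)` action at `β_W = 1/2`, `|τ| ≤ 1/5000`**: every infinite-volume limit state obeys the area law with the
constants of the `β_W = 1/2` ball and has string tension `≥ c` whenever it exists. [folklore] -/
theorem su2_rectangle_hasAreaLawWith_oneHalf (τ : ℝ) (hτ : |τ| ≤ 1 / 5000) :
    ∃ C c : ℝ, 0 < c ∧ (perturbedLimitPoints (1 / 4) (fun L : ℕ => termPerturbation (rectFamily 4 (L + 1) 2 τ))).Nonempty ∧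
      ∀ μ ∈ perturbedLimitPoints (1 / 4) (fun L : ℕ => termPerturbation (rectFamily 4 (L + 1) 2 τ)),
        HasAreaLawWith μ (fun g => normalisedCharacter 2 (fundamentalRep (Fin 2) g)) C c ∧
        ((∃ σ : ℝ, HasStringTension μ (fun g => normalisedCharacter 2 (fundamentalRep (Fin 2) g)) σ) →
          c ≤ suFundStringTension 2 μ) := by
  obtain ⟨C, c, hc, hA⟩ := su2_stringTension_onBall_oneHalf 2 (mv := 2) (by norm_num)
  exact ⟨C, c, hc, perturbedLimitPoints_nonempty _ _, hA _ (rectangle_eventually_mem' τ hτ)⟩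

/-- CONSISTENCY (the Wilson member): at `𝓦 = 0` the statement is about the tree's `infiniteVolumeLimitPoints (fundamentalRep (Fin 2)) (1/6)`
(`perturbedLimitPoints_zero`) — every infinite-volume limit point of the `SU(2)` Wilson states at `β_W = 1/3` obeys `HasAreaLawWith` with the
ball's constants. [folklore] -/
theorem su2_wilson_hasAreaLawWith_oneThird :
    ∃ C c : ℝ, 0 < c ∧ ∀ μ ∈ infiniteVolumeLimitPoints (d := 4) (fundamentalRep (Fin 2)) (1 / 6),
      HasAreaLawWith μ (fun g => normalisedCharacter 2 (fundamentalRep (Fin 2) g)) C c := by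
  obtain ⟨C, c, hc, hA⟩ := su2_stringTension_onBall_oneThird 0 (mv := 1) le_rfl
  refine ⟨C, c, hc, fun μ hμ => (hA 0 (Eventually.of_forall fun L => ?_) μ ?_).1⟩
  · exact ⟨zero_mem_clusterDomainFR (by norm_num) (by norm_num) 0,
      ⟨fun v t z _ U => by simp [QuasiLocalGaugePerturbation.total], fun X v => ⟨0, by
        intro U V _; rfl⟩⟩⟩
  · rwa [perturbedLimitPoints_zero]

end Summit.Ventures.YMGap.RobustBall

end
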